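import Literature.LinearAlgebra.QuadraticForm.WittClassZero
import Literature.LinearAlgebra.QuadraticForm.WittDecomposition
import HarnessLib

/-!
# The anisotropic kernel form is unique; Witt equivalence = isometry of kernel forms (characteristic `≠ 2`)

Topic `LinearAlgebra/QuadraticForm`; namespace `Literature.LinearAlgebra.QuadraticForm`. KERNEL mathematics only
(theorems + private plumbing; no named fact, no `axiom`, no `sorry`). Completes the tree's Witt theory
(`WittEquivalence`, `WittCancellation`, `MetabolicHyperbolic`, `WittEquivalenceSpaces`, `WittGroup`,
`WittDecomposition`, `WittClassZero`) with [Knebusch2010, Ch. 1 §1.2]: Thm 1.6 (b) "The isometry class of `φ₀` is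
uniquely determined by `φ`" (`φ ≅ φ₀ ⊥ metabolic`, `φ₀` anisotropic — the kernel form `ker φ`, Def. 1.8 (a)), and
Def. 1.8 (b) "Two forms `φ, ψ` over `K` are called Witt equivalent … if `ker φ ≅ ker ψ`" — shown to agree with
the tree's `WittEquivalent` for quadratic spaces.

* `nondegenerate_polarForm_of_anisotropic`: anisotropic ⇒ quadratic space (`2 ≠ 0`).
* `IsMetabolic.equivalent_dualProd_prod_dualProd`: a metabolic space of dimension `2(a + c)` is `H_a ⊥ H_c`
  (`H_n` = duality form on `(Kⁿ)* ⊕ Kⁿ`).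
* `anisotropic_kernel_unique` (**Thm 1.6 (b)**): `Q₀ ⊥ M ≅ Q₀' ⊥ M'` with `Q₀, Q₀'` anisotropic, `M, M'` metabolic
  ⇒ `Q₀ ≅ Q₀'` (split `M' ≅ H_a ⊥ H_c`, cancel `H_a ≅ M`, then `Q₀ ≅ Q₀' ⊥ H_c` forces `c = 0` by anisotropy).
* `wittEquivalent_iff_kernel_equivalent` (**Def. 1.8 (b) ⇔ `WittEquivalent`**) for quadratic spaces given with
  Witt decompositions.

## References

* [Knebusch2010] M. Knebusch, *Specialization of Quadratic and Symmetric Bilinear Forms*, Springer (2010), Ch. 1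
  §1.2, Thm 1.6, Def. 1.8, Thm 1.9.
-/

set_option autoImplicit false

noncomputable section

open QuadraticMap Module

namespace Literature.LinearAlgebra.QuadraticForm

universe u v v' w w'

variable {K : Type u} [Field K]
variable {V : Type v} [AddCommGroup V] [Module K V]

/-- **an anisotropic form is a quadratic space** (`2 ≠ 0`): radical vectors are isotropic.
[cite: Knebusch2010, Ch. 1 §1.2 (1)] -/
theorem nondegenerate_polarForm_of_anisotropic [NeZero (2 : K)] {Q : QuadraticForm K V} (h : Q.Anisotropic) :
    (polarForm Q).Nondegenerate := by
  refine nondegenerate_polarForm_of_radical_eq_bot (eq_bot_iff.2 fun r hr => ?_)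
  rw [Submodule.mem_bot]
  exact h r (QuadraticMap.mem_radical_iff'.1 hr).1

/-- `Kᵃ⁺ᶜ ≅ Kᵃ × Kᶜ` along `b = a + c` (plumbing). [folklore] -/
private def finSplitEquiv' {a b c : ℕ} (h : b = a + c) : (Fin b → K) ≃ₗ[K] (Fin a → K) × (Fin c → K) :=
  (LinearEquiv.funCongrLeft K K (finSumFinEquiv.trans (finCongr h.symm))).trans
    (LinearEquiv.sumArrowLequivProdArrow (Fin a) (Fin c) K K)

/-- **a metabolic space of dimension `2(a + c)` is `H_a ⊥ H_c`**, `H_n` the duality form on `(Kⁿ)* ⊕ Kⁿ`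
(metabolic = hyperbolic, and hyperbolic spaces split by dimension). [cite: Knebusch2010, Ch. 1 §1.2 (3)–(4),
Lemma 1.7] -/
theorem IsMetabolic.equivalent_dualProd_prod_dualProd [NeZero (2 : K)] [FiniteDimensional K V]
    {N : QuadraticForm K V} (hN : IsMetabolic N) {a c : ℕ} (hdim : finrank K V = 2 * (a + c)) :
    N.Equivalent ((QuadraticForm.dualProd K (Fin a → K)).prod (QuadraticForm.dualProd K (Fin c → K))) := by
  obtain ⟨hB, X, hX⟩ := hN
  have d := hX.two_mul_finrank hB
  haveI : Module.Free K X := Module.Free.of_divisionRing K X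
  have eX : X ≃ₗ[K] ((Fin a → K) × (Fin c → K)) :=
    (LinearEquiv.ofFinrankEq X (Fin (a + c) → K) (by rw [Module.finrank_fin_fun]; omega)).trans
      (finSplitEquiv' rfl)
  exact ((hX.equivalent_dualProd hB).trans ⟨QuadraticForm.dualProdIsometry eX⟩).trans
    ⟨QuadraticForm.dualProdProdIsometry⟩

/-- `P ⊕ H ≅ P` when `H` lives on the zero space (plumbing). [folklore] -/
private def prodSubsingletonEquiv {Z : Type*} [AddCommGroup Z] [Module K Z] [Subsingleton Z]
    (P : QuadraticForm K V) (H : QuadraticForm K Z) : (P.prod H).IsometryEquiv P where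
  toLinearEquiv :=
    { toFun := Prod.fst
      invFun := fun v => (v, 0)
      map_add' := fun _ _ => rfl
      map_smul' := fun _ _ => rfl
      left_inv := fun p => Prod.ext rfl (Subsingleton.elim _ _)
      right_inv := fun _ => rfl }
  map_app' p := by
    change P p.1 = (P.prod H) p
    rw [QuadraticMap.prod_apply, Subsingleton.elim p.2 0, map_zero, add_zero]

/-- reassociation (plumbing). [folklore] -/
private def prodAssocEquiv₅ {M₁ M₂ M₃ : Type*} [AddCommGroup M₁] [Module K M₁] [AddCommGroup M₂]
    [Module K M₂] [AddCommGroup M₃] [Module K M₃] (Q₁ : QuadraticForm K M₁) (Q₂ : QuadraticForm K M₂)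
    (Q₃ : QuadraticForm K M₃) : ((Q₁.prod Q₂).prod Q₃).IsometryEquiv (Q₁.prod (Q₂.prod Q₃)) where
  toLinearEquiv := LinearEquiv.prodAssoc K M₁ M₂ M₃
  map_app' x := by
    obtain ⟨⟨a, b⟩, c⟩ := x
    simp only [QuadraticMap.prod_apply]
    change Q₁ a + (Q₂ b + Q₃ c) = Q₁ a + Q₂ b + Q₃ c
    rw [add_assoc]

section Unique

variable {A : Type v} [AddCommGroup A] [Module K A] [FiniteDimensional K A]
variable {A' : Type v'} [AddCommGroup A'] [Module K A'] [FiniteDimensional K A']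
variable {W : Type w} [AddCommGroup W] [Module K W] [FiniteDimensional K W]
variable {W' : Type w'} [AddCommGroup W'] [Module K W'] [FiniteDimensional K W']

/-- the case `dim M ≤ dim M'` of the uniqueness of the kernel form. [cite: Knebusch2010, Ch. 1 §1.2 Thm 1.6 (b)] -/
private theorem anisotropic_kernel_unique_aux [NeZero (2 : K)] {Q₀ : QuadraticForm K A}
    {Q₀' : QuadraticForm K A'} {M : QuadraticForm K W} {M' : QuadraticForm K W'} (h₀ : Q₀.Anisotropic)
    (h₀' : Q₀'.Anisotropic) (hM : IsMetabolic M) (hM' : IsMetabolic M')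
    (e : (Q₀.prod M).Equivalent (Q₀'.prod M')) (hle : finrank K W ≤ finrank K W') : Q₀.Equivalent Q₀' := by
  obtain ⟨hB, X, hX⟩ := id hM
  obtain ⟨hB', X', hX'⟩ := id hM'
  have d := hX.two_mul_finrank hB
  have d' := hX'.two_mul_finrank hB'
  set a := finrank K X
  set a' := finrank K X'
  set Ha := QuadraticForm.dualProd K (Fin a → K)
  set Hc := QuadraticForm.dualProd K (Fin (a' - a) → K)
  have mHa : IsMetabolic Ha := isMetabolic_dualProd _
  have mHc : IsMetabolic Hc := isMetabolic_dualProd _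
  have eM' : M'.Equivalent (Ha.prod Hc) := hM'.equivalent_dualProd_prod_dualProd (by omega)
  have eM : M.Equivalent Ha := hM.equivalent_of_finrank_eq mHa (by
    rw [Module.finrank_prod, Subspace.dual_finrank_eq, Module.finrank_fin_fun]; omega)
  -- `Q₀ ⊕ H_a ≅ (Q₀' ⊕ H_c) ⊕ H_a`, cancel `H_a`
  have e₁ : (Q₀.prod Ha).Equivalent ((Q₀'.prod Hc).prod Ha) :=
    ((((QuadraticMap.Equivalent.refl Q₀).prod eM.symm).trans e).trans
      ((QuadraticMap.Equivalent.refl Q₀').prod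
        (eM'.trans ⟨QuadraticMap.IsometryEquiv.prodComm Ha Hc⟩))).trans ⟨(prodAssocEquiv₅ Q₀' Hc Ha).symm⟩
  have e₂ : Q₀.Equivalent (Q₀'.prod Hc) :=
    equivalent_of_prod_equivalent_prod_right mHa.1 (nondegenerate_polarForm_prod (nondegenerate_polarForm_of_anisotropic h₀') mHc.1)
      e₁
  by_cases hc : a' - a = 0
  · -- `H_c` lives on the zero space
    haveI : Subsingleton (Module.Dual K (Fin (a' - a) → K) × (Fin (a' - a) → K)) :=
      subsingleton_of_forall_eq 0 ((finrank_zero_iff_forall_zero (K := K)).1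
        (by rw [Module.finrank_prod, Subspace.dual_finrank_eq, Module.finrank_fin_fun]; omega))
    exact e₂.trans ⟨prodSubsingletonEquiv Q₀' Hc⟩
  · -- otherwise `Q₀` would represent zero
    exfalso
    obtain ⟨f⟩ := e₂
    set x : Fin (a' - a) → K := fun _ => 1 with hx_def
    have hx : x ≠ 0 := fun h0 => by
      have e₃ := congrFun h0 ⟨0, Nat.pos_of_ne_zero hc⟩
      rw [hx_def, Pi.zero_apply] at e₃
      exact one_ne_zero e₃
    have hp : (Q₀'.prod Hc) (0, ((0 : Module.Dual K (Fin (a' - a) → K)), x)) = 0 := by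
      rw [QuadraticMap.prod_apply, map_zero, zero_add]
      change (0 : Module.Dual K (Fin (a' - a) → K)) x = 0
      rfl
    have hq : Q₀ (f.symm (0, ((0 : Module.Dual K (Fin (a' - a) → K)), x))) = 0 := by
      rw [← f.map_app, f.apply_symm_apply, hp]
    have h0 := h₀ _ hq
    have e₃ : ((0 : A'), ((0 : Module.Dual K (Fin (a' - a) → K)), x)) = 0 := by
      rw [← f.apply_symm_apply (0, (0, x)), h0, map_zero]
    exact hx (Prod.ext_iff.1 (Prod.ext_iff.1 e₃).2).2

/-- **uniqueness of the anisotropic kernel form** [Knebusch2010, Thm 1.6 (b)] (characteristic `≠ 2`):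
if `Q₀ ⊥ M ≅ Q₀' ⊥ M'` with `Q₀, Q₀'` anisotropic and `M, M'` metabolic (all finite-dimensional), then `Q₀ ≅ Q₀'`.
[cite: Knebusch2010, Ch. 1 §1.2 Thm 1.6 (b)] -/
theorem anisotropic_kernel_unique [NeZero (2 : K)] {Q₀ : QuadraticForm K A} {Q₀' : QuadraticForm K A'}
    {M : QuadraticForm K W} {M' : QuadraticForm K W'} (h₀ : Q₀.Anisotropic) (h₀' : Q₀'.Anisotropic)
    (hM : IsMetabolic M) (hM' : IsMetabolic M') (e : (Q₀.prod M).Equivalent (Q₀'.prod M')) :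
    Q₀.Equivalent Q₀' := by
  rcases le_total (finrank K W) (finrank K W') with h | h
  · exact anisotropic_kernel_unique_aux h₀ h₀' hM hM' e h
  · exact (anisotropic_kernel_unique_aux h₀' h₀ hM' hM e.symm h).symm

/-- **Witt equivalence is isometry of kernel forms** [Knebusch2010, Def. 1.8 (b)]: for quadratic forms `Q ≅ Q₀ ⊥ M`,
`Q' ≅ Q₀' ⊥ M'` with `Q₀, Q₀'` anisotropic and `M, M'` metabolic (so `Q, Q'` are quadratic spaces and `Q₀, Q₀'`
their kernel forms), `Q ∼ Q'` (the tree's `WittEquivalent`) iff `Q₀ ≅ Q₀'`.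
[cite: Knebusch2010, Ch. 1 §1.2 Def. 1.8, Thm 1.6, Thm 1.9] -/
theorem wittEquivalent_iff_kernel_equivalent [NeZero (2 : K)] {V' : Type v'} [AddCommGroup V'] [Module K V']
    [FiniteDimensional K V] [FiniteDimensional K V'] {Q : QuadraticForm K V} {Q' : QuadraticForm K V'}
    {Q₀ : QuadraticForm K A} {Q₀' : QuadraticForm K A'} {M : QuadraticForm K W} {M' : QuadraticForm K W'}
    (hQ : Q.Equivalent (Q₀.prod M)) (hQ' : Q'.Equivalent (Q₀'.prod M')) (h₀ : Q₀.Anisotropic)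
    (h₀' : Q₀'.Anisotropic) (hM : IsMetabolic M) (hM' : IsMetabolic M') :
    WittEquivalent Q Q' ↔ Q₀.Equivalent Q₀' := by
  constructor
  · rintro ⟨m₁, m₂, N₁, N₂, hN₁, hN₂, e⟩
    -- pass to the quadratic spaces `N̂ᵢ` of the split witnesses
    obtain ⟨W₁, hW₁⟩ := N₁.radical.exists_isCompl
    obtain ⟨W₂, hW₂⟩ := N₂.radical.exists_isCompl
    have s₁ := equivalent_restrict_prod_zero_radical N₁ hW₁.symm
    have s₂ := equivalent_restrict_prod_zero_radical N₂ hW₂.symm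
    have n₁ : (polarForm (N₁.restrict W₁)).Nondegenerate :=
      nondegenerate_polarForm_of_radical_eq_bot (radical_restrict_eq_bot_of_isCompl N₁ hW₁.symm)
    have n₂ : (polarForm (N₂.restrict W₂)).Nondegenerate :=
      nondegenerate_polarForm_of_radical_eq_bot (radical_restrict_eq_bot_of_isCompl N₂ hW₂.symm)
    have l₁ : IsMetabolic (N₁.restrict W₁) := (hN₁.restrict_of_isCompl_radical hW₁.symm).isMetabolic n₁
    have l₂ : IsMetabolic (N₂.restrict W₂) := (hN₂.restrict_of_isCompl_radical hW₂.symm).isMetabolic n₂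
    have nQ : (polarForm Q).Nondegenerate :=
      nondegenerate_polarForm_of_equivalent hQ.symm
        (nondegenerate_polarForm_prod (nondegenerate_polarForm_of_anisotropic h₀) hM.1)
    have nQ' : (polarForm Q').Nondegenerate :=
      nondegenerate_polarForm_of_equivalent hQ'.symm
        (nondegenerate_polarForm_prod (nondegenerate_polarForm_of_anisotropic h₀') hM'.1)
    -- `(Q ⊕ N̂₁) ⊕ 0 ≅ (Q' ⊕ N̂₂) ⊕ 0`, zeros cancel
    have e' : ((Q.prod (N₁.restrict W₁)).prod (0 : QuadraticForm K N₁.radical)).Equivalent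
        ((Q'.prod (N₂.restrict W₂)).prod (0 : QuadraticForm K N₂.radical)) :=
      (QuadraticMap.Equivalent.trans ⟨prodAssocEquiv₅ Q (N₁.restrict W₁) 0⟩
        (((QuadraticMap.Equivalent.refl Q).prod s₁.symm).trans e)).trans
        (((QuadraticMap.Equivalent.refl Q').prod s₂).trans ⟨(prodAssocEquiv₅ Q' (N₂.restrict W₂) 0).symm⟩)
    have e'' := equivalent_of_prod_zero_equivalent_prod_zero (nondegenerate_polarForm_prod nQ n₁)
      (nondegenerate_polarForm_prod nQ' n₂) e'
    -- `Q₀ ⊕ (M ⊕ N̂₁) ≅ Q₀' ⊕ (M' ⊕ N̂₂)`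
    have e₃ : (Q₀.prod (M.prod (N₁.restrict W₁))).Equivalent (Q₀'.prod (M'.prod (N₂.restrict W₂))) :=
      ((QuadraticMap.Equivalent.trans ⟨(prodAssocEquiv₅ Q₀ M _).symm⟩ ((hQ.symm.prod
        (QuadraticMap.Equivalent.refl _)).trans e'')).trans
          (hQ'.prod (QuadraticMap.Equivalent.refl _))).trans ⟨prodAssocEquiv₅ Q₀' M' _⟩
    exact anisotropic_kernel_unique h₀ h₀' (hM.prod l₁) (hM'.prod l₂) e₃
  · intro h
    exact (((WittEquivalent.of_equivalent hQ).trans (WittEquivalent.prod_of_hasLagrangian Q₀ hM.hasLagrangian)).trans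
      (WittEquivalent.of_equivalent h)).trans
      (((WittEquivalent.of_equivalent hQ').trans
        (WittEquivalent.prod_of_hasLagrangian Q₀' hM'.hasLagrangian)).symm)

end Unique

end Literature.LinearAlgebra.QuadraticForm
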